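import Summits.HubbardSuperconductivity.HubbardSuperconductivity.Theorems.TwTipContinuation.Negative.TipNormalForm
import Summits.HubbardSuperconductivity.HubbardSuperconductivity.Theorems.ThermalWedgeTwTipContinuationEdgeOrder

/-!
# `TwTipContinuation` (stmt-HubbardSuperconductivity-1700) — line `isogap-submodular-transport`, lead skeleton v5
# (PENALTY-SIDE reshape: two stubs, one open; no Danskin, no homogeneity)

Lead seat c2 (prover-line-stmt-HubbardSuperconductivity-1700-c2-0), 2026-08-16.

Crux (route `ThermalWedge`, rank 6): `Summit.HubbardSuperconductivity.HubbardSuperconductivity.Theses.ThermalWedge.TwTipContinuation`.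
By `twTipContinuation_of_uniformSummit` + `summitMatrix_of_everyGSOrder` (Theorems/TwTipContinuation/Negative/TipNormalForm.lean)
it suffices to produce, at ONE `δ ∈ [1/10,2/5]` and for ALL `U ∈ (0,U₁]`, an eventual uniform EVERY-ground-state bound
`c L⁴ ≤ re⟨ψ, P_L ψ⟩` for the PURE torus `hubbardTorus 2 L 1 U` in the sector `(2⌊(1-δ)L²/2⌋, S^z = 0)`
(`P_L = (pairField d L)ᴴ (pairField d L)`); the RUNG antecedent of the crux is discarded (Disproof §1/§5).

RESHAPE v4 → v5 (same composition idea — transport of the seed response of the pure torus against the EXACTLY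
ORDERED `U = 0` reduced-BCS edge, whose every-GS order `stub_edgeOrder` is LANDED, p79900 — but probed from the
PENALTY side `g < 0` instead of the attractive side `g > 0`). Write `E_L(U,g) := minEnergyOn (hubbardTorus 2 L 1 U − (g/L²)P_L) (szSector (2n) 0)`,
`n = ⌊(1-δ)L²/2⌋`, so that `E_L(U,−s)` is the sector energy of the pure torus with the d-wave PENALTY `+(s/L²)P_L`.
* v4 (lead 0 / c1): `stub_isogapTransport` (attractive strip `s ∈ (0,s₁]`, all widths) ⇒ right-hand slope at the pure corner ⇒
  Danskin attainment (`s ↓ 0`, compactness) ⇒ SOME ordered ground state ⇒ `stub_groundSpaceHomogeneity` (every-GS layer, open bet).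
* v5 (this file): ONE penalty width suffices and the every-GS layer disappears, because the LEFT chord at the pure corner
  (`Negative.leftChord_le_order` with `g' = −s < 0 = g`) bounds the pair intensity of EVERY ground state of the pure torus from
  below by the penalty cost: `(s/L²)·re⟨ψ,P_Lψ⟩ ≥ E_L(U,−s) − E_L(U,0)` for every normalised sector GS `ψ` of `hubbardTorus 2 L 1 U`
  and every `s > 0` — no limit `s ↓ 0`, no Danskin, no homogeneity (cf. the landed `everyGSOrder_pure_iff_suppressionCost`,
  Negative/CornerDanskin.lean: on the penalty side the every-GS order bound IS an energy inequality).
Stubs (≤ 7, registered on stmt-HubbardSuperconductivity-1700):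
* `stub_edgeOrder` — LANDED (p79900, imported): every GS of the `U = 0` reduced d-wave BCS torus at seed `c > 0` has `re⟨P_L⟩ ≥ μ(δ,c) L⁴`;
* `stub_penaltyTransport` — OPEN (XL, the lead's): at one `δ ∈ [1/10,3/10]` there are `U₁, a > 0` such that for every `U ∈ (0,U₁]`
  some penalty width `s ∈ (0, aU²)` satisfies, for every `ε > 0`, eventually in even `L`:
  `E_L(0,aU²−s) − E_L(0,aU²) − ε s L² ≤ E_L(U,−s) − E_L(U,0)` — the pure torus at coupling `U` RESISTS a d-wave penalty of width `s`
  at least as much as the free reduced-BCS edge loses between the seeds `aU²` and `aU² − s` (Kohn–Luttinger sign with an `O(1)` relative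
  margin `a`; by the chords it says: min-GS d-wave order of the pure torus ≥ max-GS order of the edge at seed `aU² − s`, see the normal
  form in Theorems/ThermalWedgeTwTipContinuationPenaltyTransport.lean).
Composition `TwTipContinuation_of`: edge order `μ = μ(δ, aU²−s)` ⇒ (right chord at a GS of the edge at seed `aU²−s`) edge loss
`≥ μ s L²` ⇒ (penalty transport, `ε = μ/2`) pure penalty cost `≥ (μ/2) s L²` ⇒ (left chord at the pure corner) EVERY GS of the pure
torus has `re⟨P_L⟩ ≥ (μ/2) L⁴` ⇒ `summitMatrix_of_everyGSOrder` ⇒ `twTipContinuation_of_uniformSummit`.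

All statements are on the LITERAL route terms (no local abbreviations), so that each stub can land verbatim as a `--supports` helper.
-/

noncomputable section

namespace Summit.HubbardSuperconductivity.TwTipContinuation.IsogapTransport

open Matrix Filter Finset
open Literature.MathematicalPhysics.QuantumLattice Literature.Probability.LatticeModels
open Summit.HubbardSuperconductivity.HubbardSuperconductivity.Theses.ThermalWedge
open Summit.HubbardSuperconductivity.TwTipContinuation.Negative
open scoped ComplexOrder

/-! ### The stubs (registered on stmt-HubbardSuperconductivity-1700): one landed (imported), one open -/

-- `stub_edgeOrder` LANDED (p79900): Theorems/ThermalWedgeTwTipContinuationEdgeOrder.lean (imported; `IsogapTransport.stub_edgeOrder`).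

/-- STUB (XL, crux-sized — held by the line lead): **PENALTY-SIDE transport against the reduced-BCS edge.** At one doping of
the B1g window there are `U₁, a > 0` such that for every `U ∈ (0,U₁]` some penalty width `s ∈ (0, aU²)` satisfies, for every
`ε > 0`, eventually in even `L`: the pure torus `hubbardTorus 2 L 1 U` pays for the d-wave penalty `+(s/L²)P_L` at least what the
`U = 0` reduced-BCS edge loses between the seeds `aU²` and `aU² − s`, up to `ε s L²`. (Kohn–Luttinger sign with an `O(1)` relative
margin `a`; by the chords it is the EVERY-ground-state d-wave order floor `m²(U, pure) ≥ m²_BCS(aU² − s)` — the weak-coupling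
d-wave superconductivity of the pure 2D Hubbard torus with a BCS-calibrated rate; no rigorous source.)
Kohn–Luttinger 1965; Raghu–Kivelson–Scalapino 2010 §III. [folklore] -/
theorem stub_penaltyTransport :
    ∃ δ ∈ Set.Icc (1 / 10 : ℝ) (3 / 10), ∃ U₁ a : ℝ, 0 < U₁ ∧ 0 < a ∧ ∀ U ∈ Set.Ioc (0 : ℝ) U₁, ∃ s : ℝ, 0 < s ∧ s < a * U ^ 2 ∧
      ∀ ε : ℝ, 0 < ε → ∃ L₀ : ℕ, ∀ (L : ℕ) [NeZero L], L₀ ≤ L → Even L →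
        (Matrix.minEnergyOn (hubbardTorus 2 L 1 0 - (((a * U ^ 2 - s) / (L : ℝ) ^ 2 : ℝ) : ℂ) • ((pairField dWaveFormFactor L)ᴴ * pairField dWaveFormFactor L)) (szSector (2 * ⌊(1 - δ) * (L : ℝ) ^ 2 / 2⌋₊) 0))
          - (Matrix.minEnergyOn (hubbardTorus 2 L 1 0 - ((a * U ^ 2 / (L : ℝ) ^ 2 : ℝ) : ℂ) • ((pairField dWaveFormFactor L)ᴴ * pairField dWaveFormFactor L)) (szSector (2 * ⌊(1 - δ) * (L : ℝ) ^ 2 / 2⌋₊) 0))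
          - ε * s * (L : ℝ) ^ 2 ≤
        (Matrix.minEnergyOn (hubbardTorus 2 L 1 U + ((s / (L : ℝ) ^ 2 : ℝ) : ℂ) • ((pairField dWaveFormFactor L)ᴴ * pairField dWaveFormFactor L)) (szSector (2 * ⌊(1 - δ) * (L : ℝ) ^ 2 / 2⌋₊) 0))
          - (Matrix.minEnergyOn (hubbardTorus 2 L 1 U) (szSector (2 * ⌊(1 - δ) * (L : ℝ) ^ 2 / 2⌋₊) 0)) := by
  sorry

/-! ### Composition (sorry-free modulo the one open stub) -/

/-- The penalised pure torus is the seeded family at the negative seed `−s`: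
`H + (s/L²)P_L = H − ((−s)/L²)P_L`. [folklore] -/
theorem penalised_eq_seeded (U s : ℝ) (L : ℕ) [NeZero L] :
    hubbardTorus 2 L 1 U + ((s / (L : ℝ) ^ 2 : ℝ) : ℂ) • ((pairField dWaveFormFactor L)ᴴ * pairField dWaveFormFactor L) =
      hubbardTorus 2 L 1 U - (((-s) / (L : ℝ) ^ 2 : ℝ) : ℂ) • ((pairField dWaveFormFactor L)ᴴ * pairField dWaveFormFactor L) := by
  rw [neg_div, Complex.ofReal_neg, neg_smul, sub_neg_eq_add]

/-- **Left chord at the pure corner, penalty form**: for every normalised sector ground state `ψ` of the PURE torus and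
every penalty width `s > 0`, `E_L(U,−s) − E_L(U,0) ≤ (s/L²)·re⟨ψ,P_Lψ⟩` — the penalty cost bounds the pair intensity of
EVERY ground state from below (no limit, no Danskin, no homogeneity). [folklore] -/
theorem penaltyCost_le_order {U s : ℝ} {L : ℕ} [NeZero L] {n : ℕ} (hs : 0 < s)
    {ψ : Fock (Orb (FermionTorus 2 L))} (hψ : star ψ ⬝ᵥ ψ = 1)
    (hgs : IsGroundStateInSector (hubbardTorus 2 L 1 U) (2 * n) 0 ψ) :
    (Matrix.minEnergyOn (hubbardTorus 2 L 1 U + ((s / (L : ℝ) ^ 2 : ℝ) : ℂ) • ((pairField dWaveFormFactor L)ᴴ * pairField dWaveFormFactor L)) (szSector (2 * n) 0))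
      - (Matrix.minEnergyOn (hubbardTorus 2 L 1 U) (szSector (2 * n) 0)) ≤
      s / (L : ℝ) ^ 2 * (expect ((pairField dWaveFormFactor L)ᴴ * pairField dWaveFormFactor L) ψ).re := by
  have hgs0 : IsGroundStateInSector (hubbardTorus 2 L 1 U - ((0 / (L : ℝ) ^ 2 : ℝ) : ℂ) • ((pairField dWaveFormFactor L)ᴴ * pairField dWaveFormFactor L)) (2 * n) 0 ψ := by
    rw [seededH_zero]; exact hgs
  have hl := leftChord_le_order (U := U) (g := 0) (g' := -s) (by linarith) hψ hgs0
  rw [seededH_zero, ← penalised_eq_seeded, sub_neg_eq_add, zero_add] at hl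
  exact hl

/-- **Right chord on the edge, loss form**: every-GS order `μ L⁴` of the seeded torus at seed `c − s` (`s > 0`) forces the
loss `E_L(U,c−s) − E_L(U,c) ≥ μ s L²` (right chord at a normalised ground state at seed `c − s`, which exists in the sector
`(2n,0)`, `n ≤ L²`). [folklore] -/
theorem loss_of_order {U c s μ : ℝ} {L : ℕ} [NeZero L] {n : ℕ} (hn : n ≤ Fintype.card (FermionTorus 2 L)) (hs : 0 < s)
    (h : ∀ ψ : Fock (Orb (FermionTorus 2 L)), star ψ ⬝ᵥ ψ = 1 →
      IsGroundStateInSector (hubbardTorus 2 L 1 U - (((c - s) / (L : ℝ) ^ 2 : ℝ) : ℂ) • ((pairField dWaveFormFactor L)ᴴ * pairField dWaveFormFactor L)) (2 * n) 0 ψ →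
        μ * (L : ℝ) ^ 4 ≤ (expect ((pairField dWaveFormFactor L)ᴴ * pairField dWaveFormFactor L) ψ).re) :
    μ * s * (L : ℝ) ^ 2 ≤
      (Matrix.minEnergyOn (hubbardTorus 2 L 1 U - (((c - s) / (L : ℝ) ^ 2 : ℝ) : ℂ) • ((pairField dWaveFormFactor L)ᴴ * pairField dWaveFormFactor L)) (szSector (2 * n) 0))
        - (Matrix.minEnergyOn (hubbardTorus 2 L 1 U - ((c / (L : ℝ) ^ 2 : ℝ) : ℂ) • ((pairField dWaveFormFactor L)ᴴ * pairField dWaveFormFactor L)) (szSector (2 * n) 0)) := by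
  obtain ⟨φ, hφ, hφgs⟩ := exists_unit_groundState U (c - s) L hn
  have hr := order_le_rightChord (U := U) (g := c - s) (g'' := c) (by linarith) hφ hφgs
  have hb := h φ hφ hφgs
  have hL : (0 : ℝ) < (L : ℝ) ^ 2 := by
    have := NeZero.pos L
    positivity
  have key : (c - (c - s)) / (L : ℝ) ^ 2 * (μ * (L : ℝ) ^ 4) ≤
      (c - (c - s)) / (L : ℝ) ^ 2 * (expect ((pairField dWaveFormFactor L)ᴴ * pairField dWaveFormFactor L) φ).re :=
    mul_le_mul_of_nonneg_left hb (div_nonneg (by linarith) hL.le)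
  have hid : (c - (c - s)) / (L : ℝ) ^ 2 * (μ * (L : ℝ) ^ 4) = μ * s * (L : ℝ) ^ 2 := by
    field_simp
    ring
  linarith

/-- **The line's composition (v5)**: the two stubs give `TwTipContinuation` (entry through `twTipContinuation_of_uniformSummit`;
the RUNG antecedent is unused; no Danskin attainment and no ground-space homogeneity). [folklore] -/
theorem TwTipContinuation_of : TwTipContinuation := by
  obtain ⟨δ, hδ3, U₁, a, hU₁, _ha, hT⟩ := stub_penaltyTransport
  have hδ : δ ∈ Set.Icc (1 / 10 : ℝ) (2 / 5) := ⟨hδ3.1, hδ3.2.trans (by norm_num)⟩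
  refine twTipContinuation_of_uniformSummit ⟨U₁, hU₁, δ, hδ, fun U hU => ?_⟩
  apply summitMatrix_of_everyGSOrder
  have hδ' : (-1 : ℝ) ≤ δ := by linarith [hδ.1]
  obtain ⟨s, hs, hsa, hT'⟩ := hT U hU
  -- edge order at the smaller seed `a U² − s > 0`
  obtain ⟨μ, hμ, L₁, hE⟩ := stub_edgeOrder δ hδ (a * U ^ 2 - s) (by linarith)
  obtain ⟨L₂, hT''⟩ := hT' (μ / 2) (by positivity)
  refine ⟨μ / 2, by positivity, max L₁ L₂, fun L _ hL hEv ψ hψ hgs => ?_⟩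
  have hL₁ : L₁ ≤ L := le_trans (le_max_left _ _) hL
  have hL₂ : L₂ ≤ L := le_trans (le_max_right _ _) hL
  have hn : ⌊(1 - δ) * (L : ℝ) ^ 2 / 2⌋₊ ≤ Fintype.card (FermionTorus 2 L) := by
    rw [Summit.HubbardSuperconductivity.NoGo.card_fermionTorus_two]
    exact Summit.HubbardSuperconductivity.NoGo.floor_pairNumber_le δ hδ' L
  have hLpos : (0 : ℝ) < (L : ℝ) ^ 2 := by
    have := NeZero.pos L
    positivity
  -- Step A: the edge loses at least `μ s L²` between the seeds `aU²` and `aU² − s`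
  have hA := loss_of_order (U := 0) (c := a * U ^ 2) (μ := μ) hn hs (hE L hL₁ hEv)
  -- Step B: penalty transport with `ε = μ/2`: the pure torus pays at least `(μ/2) s L²` for the penalty of width `s`
  have hB := hT'' L hL₂ hEv
  -- Step C: left chord at the pure corner — EVERY ground state carries the penalty cost
  have hC := penaltyCost_le_order (U := U) hs hψ hgs
  have hkey : μ / 2 * s * (L : ℝ) ^ 2 ≤ s / (L : ℝ) ^ 2 * (expect ((pairField dWaveFormFactor L)ᴴ * pairField dWaveFormFactor L) ψ).re := by
    linarith
  have hkey' : s * (μ / 2 * (L : ℝ) ^ 4) ≤ s * (expect ((pairField dWaveFormFactor L)ᴴ * pairField dWaveFormFactor L) ψ).re := by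
    have h1 := mul_le_mul_of_nonneg_left hkey hLpos.le
    have e1 : (L : ℝ) ^ 2 * (μ / 2 * s * (L : ℝ) ^ 2) = s * (μ / 2 * (L : ℝ) ^ 4) := by ring
    have e2 : (L : ℝ) ^ 2 * (s / (L : ℝ) ^ 2 * (expect ((pairField dWaveFormFactor L)ᴴ * pairField dWaveFormFactor L) ψ).re) =
        s * (expect ((pairField dWaveFormFactor L)ᴴ * pairField dWaveFormFactor L) ψ).re := by
      rw [← mul_assoc, mul_div_assoc', mul_div_cancel_left₀ s (ne_of_gt hLpos)]
    rw [e1, e2] at h1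
    exact h1
  exact le_of_mul_le_mul_left hkey' hs

end Summit.HubbardSuperconductivity.TwTipContinuation.IsogapTransport

end
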